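import Literature.Probability.Moments.PairSumVariance
import Summits.AtomisticToContinuum.HydrodynamicLimit.Theorems.JParityClosureEvenStressEnskogEnskogRateMeanRung0
import Summits.AtomisticToContinuum.HydrodynamicLimit.Theorems.JParityClosureEvenStressEnskogVelocityFactorisation
import Literature.MathematicalPhysics.KineticTheory.HardSphereUniformDensityLLN
import HarnessLib

/-!
# Mean-square deviation of the Enskog integrand at rung 0 (`stub_enskogRateSqDeviationRung0`, static
# input of the helper stub (hE)₀ `stub_enskogRateVarianceRung0` of the crux line
# `even-rung-mean-variance`, `JParityClosure.EvenStressEnskog`, stmt-AtomisticToContinuum-13079)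

Under the rung-0 local Gibbs law `G_N` (constant profiles; positions `posGibbsMeasure`, velocities
i.i.d. `N(u, θ id)`, independent: `integral_localGibbsLaw_rung0`) the mean-square deviation at a point
`x₀ ∈ 𝕋³` of the Enskog integrand `ψ(σ³ρ_r(z,x₀)) B_r Ξ_L (z,x₀)` from the constant `ψ(σ³) Θ̄`,
`Θ̄ = ∫ Θ Ξ_L d(N(u,θ) ⊗ N(u,θ))`, is bounded by
`2K² · 8M⁴(4L²|S²|)²/(N+1) + 2Θ̄²(KM² + K)·[(K(M+1)+1)ε + C_{ε,δ} E_P(ρ̃_r(·,x₀) − 1)² + KM²/(N+1)]`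
(`M = 3/(πr³)`, `|ψ| ≤ K` on `[0,∞)`, `|ψ y − ψ(σ³)| < ε` for `|y − σ³| < δ`).  Ingredients: the pointwise
split `(ψ(σ³ρ)B − ψ(σ³)Θ̄)² ≤ 2K²(B − Θ̄Q)² + 2Θ̄²D|ψ(σ³ρ)Q − ψ(σ³)|` (`Q` the off-diagonal pair average of
the cone weights), the deterministic estimate `abs_mul_offDiag_sub_le`, and — the new input — the
VELOCITY VARIANCE of the pair functional at fixed positions: an order-2 `U`-statistic of the i.i.d.
Maxwellian velocities with weights `O((N+1)⁻²)`, of variance `O(1/(N+1))` by the Efron–Stein bound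
`variance_weightedPairSum_le`.
-/

noncomputable section

open MeasureTheory ProbabilityTheory Set Filter Topology
open scoped ENNReal InnerProductSpace BigOperators

namespace Summit.AtomisticToContinuum.HydrodynamicLimit.Theorems.EvenStressEnskog

open Literature.Analysis.FluidPDE Literature.MathematicalPhysics.KineticTheory
open Literature.MathematicalPhysics.StatisticalMechanics Literature.Probability.Moments

/-! ## The velocity `U`-statistic at fixed positions -/

/-- **Variance of the pair functional in the velocities, at fixed positions.**  Under
`⊗ᵢ N(u, θ id)` the pair functional `B_r Ξ_L (zipConfig (x, v), x₀) = Σ_a Σ_b w_{ab} Θ(v_a, v_b)`,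
`w_{ab} = (N+1)⁻² b_r(x_a,x₀) b_r(x_b,x₀)`, is a weighted pair sum with `|w| ≤ M²/(N+1)²`,
`M = 3/(πr³)`, and kernel `|Θ Ξ_L| ≤ 4L²|S²|`; hence `Var ≤ 8 M⁴ (4L²|S²|)² / (N+1)`
(`variance_weightedPairSum_le`). [folklore] -/
theorem variance_vel_pairFunctional_le {N : ℕ} (u : V3) (θ : ℝ) (k l : Fin 3) {L r : ℝ}
    (hL : 0 ≤ L) (hr : 0 < r) (xs : Fin (N + 1) → T3) (x₀ : T3) :
    variance (fun vs => pairFunctional r (evenMarkTrunc k l L) (zipConfig (xs, vs)) x₀)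
        (Measure.pi fun _ : Fin (N + 1) => gaussMeasure u θ) ≤
      8 * (3 / (Real.pi * r ^ 3)) ^ 4 *
        (2 * L * (2 * L) * (sphereMeasure : Measure (Metric.sphere (0 : V3) 1)).real univ) ^ 2 *
          (((N + 1 : ℕ) : ℝ))⁻¹ := by
  set M : ℝ := 3 / (Real.pi * r ^ 3) with hM
  set n : ℝ := ((N + 1 : ℕ) : ℝ) with hn
  have hn0 : 0 < n := by rw [hn]; positivity
  have hfun : (fun vs => pairFunctional r (evenMarkTrunc k l L) (zipConfig (xs, vs)) x₀) =
      fun vs : Fin (N + 1) → V3 => ∑ a, ∑ b, (n⁻¹ * n⁻¹ *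
        (coneKernel r (xs a) x₀ * coneKernel r (xs b) x₀)) *
          (fun p : V3 × V3 => sphereMark (evenMarkTrunc k l L) p.1 p.2) (vs a, vs b) := by
    funext vs
    rw [pairFunctional_eq_sum, Finset.mul_sum]
    refine Finset.sum_congr rfl fun a _ => ?_
    rw [Finset.mul_sum]
    refine Finset.sum_congr rfl fun b _ => ?_
    simp only [zipConfig_apply]
    ring
  have hΘm : Measurable fun p : V3 × V3 => sphereMark (evenMarkTrunc k l L) p.1 p.2 :=
    (continuous_sphereMark (continuous_evenMarkTrunc k l L)).measurable
  have hb : ∀ y : T3, 0 ≤ coneKernel r y x₀ ∧ coneKernel r y x₀ ≤ M := fun y =>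
    coneKernel_nonneg_le hr y x₀
  have hw : ∀ a b : Fin (N + 1),
      |n⁻¹ * n⁻¹ * (coneKernel r (xs a) x₀ * coneKernel r (xs b) x₀)| ≤ n⁻¹ * n⁻¹ * (M * M) := by
    intro a b
    rw [abs_of_nonneg (mul_nonneg (mul_nonneg (inv_nonneg.2 hn0.le) (inv_nonneg.2 hn0.le))
      (mul_nonneg (hb _).1 (hb _).1))]
    exact mul_le_mul_of_nonneg_left (mul_le_mul (hb _).2 (hb _).2 (hb _).1
      ((hb (xs a)).1.trans (hb (xs a)).2)) (mul_nonneg (inv_nonneg.2 hn0.le) (inv_nonneg.2 hn0.le))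
  rw [hfun]
  refine (variance_weightedPairSum_le (ι := Fin (N + 1)) (gaussMeasure u θ) hΘm
    (fun p => abs_sphereMark_evenMarkTrunc_le k l hL p.1 p.2) hw).trans (le_of_eq ?_)
  rw [Fintype.card_fin, ← hn]
  field_simp

/-- **Mean-square deviation of the pair functional from its velocity average**, at fixed positions:
`∫ (B_r Ξ_L (zipConfig (x,v), x₀) − Θ̄ Q(x))² dv ≤ 8 M⁴ (4L²|S²|)² / (N+1)`, where
`Θ̄ Q(x)` IS the velocity average (`integral_vel_pairFunctional`) and the left side is therefore the
variance (`variance_eq_integral`). [folklore] -/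
theorem integral_vel_sq_pairFunctional_sub_le {N : ℕ} (u : V3) (θ : ℝ) (k l : Fin 3) {L r : ℝ}
    (hL : 0 ≤ L) (hr : 0 < r) (xs : Fin (N + 1) → T3) (x₀ : T3) :
    ∫ vs, (pairFunctional r (evenMarkTrunc k l L) (zipConfig (xs, vs)) x₀ -
        (∫ p, sphereMark (evenMarkTrunc k l L) p.1 p.2 ∂((gaussMeasure u θ).prod (gaussMeasure u θ))) *
          ((((N + 1 : ℕ) : ℝ))⁻¹ * (((N + 1 : ℕ) : ℝ))⁻¹ *
            ∑ i, ∑ j, if i = j then 0 else coneKernel r (xs i) x₀ * coneKernel r (xs j) x₀)) ^ 2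
        ∂(Measure.pi fun _ : Fin (N + 1) => gaussMeasure u θ) ≤
      8 * (3 / (Real.pi * r ^ 3)) ^ 4 *
        (2 * L * (2 * L) * (sphereMeasure : Measure (Metric.sphere (0 : V3) 1)).real univ) ^ 2 *
          (((N + 1 : ℕ) : ℝ))⁻¹ := by
  have hXm : Measurable fun vs : Fin (N + 1) → V3 =>
      pairFunctional r (evenMarkTrunc k l L) (zipConfig (xs, vs)) x₀ :=
    (continuous_pairFunctional_comp r (continuous_evenMarkTrunc k l L) continuous_id
      continuous_const).measurable.comp (measurable_zipConfig.comp (measurable_const.prodMk measurable_id))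
  have hvar := variance_eq_integral (μ := Measure.pi fun _ : Fin (N + 1) => gaussMeasure u θ) hXm.aemeasurable
  rw [integral_vel_pairFunctional u θ k l hL r xs x₀] at hvar
  rw [← hvar]
  exact variance_vel_pairFunctional_le u θ k l hL hr xs x₀


/-! ## Uniform bounds -/

/-- **`N`-uniform bound on the pair functional of the truncated mark**:
`|B_r Ξ_L (z, x₀)| ≤ M² · 4L²|S²|`, `M = 3/(πr³)` (`(N+1)⁻² · (N+1)²` terms). [folklore] -/
theorem abs_pairFunctional_evenMarkTrunc_le {N : ℕ} (k l : Fin 3) {L r : ℝ} (hL : 0 ≤ L) (hr : 0 < r)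
    (z : Config (N + 1) (Fin 3) T3) (x₀ : T3) :
    |pairFunctional r (evenMarkTrunc k l L) z x₀| ≤ (3 / (Real.pi * r ^ 3)) * (3 / (Real.pi * r ^ 3)) *
      (2 * L * (2 * L) * (sphereMeasure : Measure (Metric.sphere (0 : V3) 1)).real univ) := by
  rw [pairFunctional_eq_sum]
  refine (abs_const_mul_sum_sum_le_of (B := (3 / (Real.pi * r ^ 3)) * (3 / (Real.pi * r ^ 3)) *
    (2 * L * (2 * L) * (sphereMeasure : Measure (Metric.sphere (0 : V3) 1)).real univ)) (by positivity) _
    fun i j => ?_).trans (le_of_eq ?_)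
  · rw [abs_mul, abs_mul]
    exact mul_le_mul (mul_le_mul (abs_coneKernel_le hr _ _) (abs_coneKernel_le hr _ _) (abs_nonneg _)
      (by positivity)) (abs_sphereMark_evenMarkTrunc_le k l hL _ _) (abs_nonneg _) (by positivity)
  · have hN : ((N : ℝ) + 1) ≠ 0 := by positivity
    push_cast
    field_simp

/-- `|Θ̄| ≤ 4L²|S²|` for the Maxwellian pair average `Θ̄ = ∫ Θ Ξ_L d(N(u,θ) ⊗ N(u,θ))`. [folklore] -/
theorem abs_integral_sphereMark_le (u : V3) (θ : ℝ) (k l : Fin 3) {L : ℝ} (hL : 0 ≤ L) :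
    |∫ p, sphereMark (evenMarkTrunc k l L) p.1 p.2 ∂((gaussMeasure u θ).prod (gaussMeasure u θ))| ≤
      2 * L * (2 * L) * (sphereMeasure : Measure (Metric.sphere (0 : V3) 1)).real univ := by
  have h := norm_integral_le_of_norm_le_const (μ := (gaussMeasure u θ).prod (gaussMeasure u θ))
    (f := fun p : V3 × V3 => sphereMark (evenMarkTrunc k l L) p.1 p.2)
    (C := 2 * L * (2 * L) * (sphereMeasure : Measure (Metric.sphere (0 : V3) 1)).real univ)
    (ae_of_all _ fun p => by rw [Real.norm_eq_abs]; exact abs_sphereMark_evenMarkTrunc_le k l hL p.1 p.2)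
  simpa only [Real.norm_eq_abs, probReal_univ, mul_one] using h

/-! ## The mean-square deviation at one point of the torus -/

/-- Elementary split behind the pointwise estimate:
`(ψ₁B − ψ₀Θ̄)² ≤ 2K²(B − Θ̄Q)² + 2Θ̄²D·|ψ₁Q − ψ₀|` when `|ψ₁| ≤ K` and `|ψ₁Q − ψ₀| ≤ D`
(`ψ₁B − ψ₀Θ̄ = ψ₁(B − Θ̄Q) + Θ̄(ψ₁Q − ψ₀)`, `(α+β)² ≤ 2α² + 2β²`). [folklore] -/
theorem sq_sub_le_split {ψ₁ ψ₀ B Q Θb K D : ℝ} (hψ₁ : |ψ₁| ≤ K) (hD : |ψ₁ * Q - ψ₀| ≤ D) :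
    (ψ₁ * B - ψ₀ * Θb) ^ 2 ≤ 2 * K ^ 2 * (B - Θb * Q) ^ 2 + 2 * Θb ^ 2 * D * |ψ₁ * Q - ψ₀| := by
  have e : ψ₁ * B - ψ₀ * Θb = ψ₁ * (B - Θb * Q) + Θb * (ψ₁ * Q - ψ₀) := by ring
  have h1 : (ψ₁ * (B - Θb * Q)) ^ 2 ≤ K ^ 2 * (B - Θb * Q) ^ 2 := by
    rw [mul_pow]
    refine mul_le_mul_of_nonneg_right ?_ (sq_nonneg _)
    rw [← sq_abs]
    exact pow_le_pow_left₀ (abs_nonneg _) hψ₁ 2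
  have h2 : (Θb * (ψ₁ * Q - ψ₀)) ^ 2 ≤ Θb ^ 2 * (D * |ψ₁ * Q - ψ₀|) := by
    rw [mul_pow]
    refine mul_le_mul_of_nonneg_left ?_ (sq_nonneg _)
    rw [← sq_abs, sq]
    exact mul_le_mul_of_nonneg_right hD (abs_nonneg _)
  rw [e]
  nlinarith [h1, h2, sq_nonneg (ψ₁ * (B - Θb * Q) - Θb * (ψ₁ * Q - ψ₀))]

/-- **The mean-square deviation at one point, bounded.**  Under the rung-0 local Gibbs law, for
`ψ` measurable with `|ψ| ≤ K` on `[0, ∞)` and `|ψ y − ψ(σ³)| < ε` for `|y − σ³| < δ`, at every `x₀ ∈ 𝕋³`: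
`E_G[(ψ(σ³ρ_r) B_r − ψ(σ³)Θ̄)²] ≤ 2K² · 8M⁴(4L²|S²|)²/(N+1) + 2Θ̄²(KM² + K)·[(K(M+1)+1)ε +
C_{ε,δ} E_P(ρ̃_r − 1)² + KM²/(N+1)]` — the pointwise split `sq_sub_le_split`, the deterministic
estimate `abs_mul_offDiag_sub_le`, the velocity variance `integral_vel_sq_pairFunctional_sub_le`
(positions and velocities being independent at rung 0) and the position marginal. [folklore] -/
theorem integral_sq_deviation_le {σ a θ : ℝ} {u : V3} (hσ : 0 < σ) (hσ2 : σ ≤ 1 / 2) (ha : 0 < a)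
    (hθ : 0 < θ) {ψ : ℝ → ℝ} (hψm : Measurable ψ) {K : ℝ} (hK : ∀ y, 0 ≤ y → |ψ y| ≤ K)
    {ε δ : ℝ} (hε : 0 < ε) (hδ : 0 < δ) (hcont : ∀ y, |y - σ ^ 3| < δ → |ψ y - ψ (σ ^ 3)| < ε)
    (k l : Fin 3) {L r : ℝ} (hL : 0 ≤ L) (hr : 0 < r) (x₀ : T3) (N : ℕ)
    (Φ : HardSphereFlow (Torus.geometry (Fin 3)) (hsDiameter σ N) (N + 1)) :
    ∫ z, (ψ (σ ^ 3 * mollDensity r z x₀) * pairFunctional r (evenMarkTrunc k l L) z x₀ -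
        ψ (σ ^ 3) * ∫ p, sphereMark (evenMarkTrunc k l L) p.1 p.2
          ∂((gaussMeasure u θ).prod (gaussMeasure u θ))) ^ 2
        ∂(localGibbsLaw σ (fun _ => a) (fun _ => u) (fun _ => θ) N Φ) ≤
      2 * K ^ 2 * (8 * (3 / (Real.pi * r ^ 3)) ^ 4 *
        (2 * L * (2 * L) * (sphereMeasure : Measure (Metric.sphere (0 : V3) 1)).real univ) ^ 2 *
          (((N + 1 : ℕ) : ℝ))⁻¹) +
      2 * (∫ p, sphereMark (evenMarkTrunc k l L) p.1 p.2 ∂((gaussMeasure u θ).prod (gaussMeasure u θ))) ^ 2 *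
        (K * ((3 / (Real.pi * r ^ 3)) * (3 / (Real.pi * r ^ 3))) + K) *
        ((K * (3 / (Real.pi * r ^ 3) + 1) + 1) * ε +
          (K * (3 / (Real.pi * r ^ 3) + 1) / (4 * ε) + 2 * K * (σ ^ 3) ^ 2 / δ ^ 2) *
            ∫ xs, (empDensity r xs x₀ - 1) ^ 2 ∂posGibbsMeasure (fun _ : T3 => a) (hsDiameter σ N) (N + 1) +
          K * (3 / (Real.pi * r ^ 3)) ^ 2 * (((N + 1 : ℕ) : ℝ))⁻¹) := by
  set Ξ := evenMarkTrunc k l L with hΞ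
  set s : ℝ := σ ^ 3 with hs_def
  set M : ℝ := 3 / (Real.pi * r ^ 3) with hM
  set CΘ : ℝ := 2 * L * (2 * L) * (sphereMeasure : Measure (Metric.sphere (0 : V3) 1)).real univ with hCΘ
  set n : ℝ := ((N + 1 : ℕ) : ℝ) with hn
  set Γ : Measure (Fin (N + 1) → V3) := Measure.pi fun _ : Fin (N + 1) => gaussMeasure u θ with hΓ
  set P := posGibbsMeasure (fun _ : T3 => a) (hsDiameter σ N) (N + 1) with hP
  set G := localGibbsLaw σ (fun _ => a) (fun _ => u) (fun _ => θ) N Φ with hG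
  set Θb : ℝ := ∫ p, sphereMark Ξ p.1 p.2 ∂((gaussMeasure u θ).prod (gaussMeasure u θ)) with hΘb
  set A : ℝ := K * (M + 1) + 1 with hA
  set C' : ℝ := K * (M + 1) / (4 * ε) + 2 * K * s ^ 2 / δ ^ 2 with hC'
  set D : ℝ := K * (M * M) + K with hD
  set b : Config (N + 1) (Fin 3) T3 → Fin (N + 1) → ℝ := fun z i => coneKernel r (z i).1 x₀ with hb
  set Q : Config (N + 1) (Fin 3) T3 → ℝ := fun z =>
    n⁻¹ * n⁻¹ * ∑ i, ∑ j, (if i = j then 0 else b z i * b z j) with hQ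
  set pF := pairFunctional (N := N) r Ξ with hpF
  haveI : IsProbabilityMeasure G := isProbabilityMeasure_localGibbsLaw continuous_const
    continuous_const continuous_const (fun _ => ha) (fun _ => hθ) hσ2 N Φ
  haveI : IsProbabilityMeasure P := isProbabilityMeasure_posGibbsMeasure continuous_const (fun _ => ha) hσ2 N
  have hs : 0 < s := pow_pos hσ 3
  have hn0 : 0 < n := by rw [hn]; positivity
  have hK0 : 0 ≤ K := (abs_nonneg _).trans (hK 0 le_rfl)
  have hbM : ∀ z i, 0 ≤ b z i ∧ b z i ≤ M := fun z i => coneKernel_nonneg_le hr (z i).1 x₀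
  have hM0 : 0 ≤ M := by rw [hM]; positivity
  have hD0 : 0 ≤ D := by rw [hD]; positivity
  have hΞc : Continuous Ξ := continuous_evenMarkTrunc k l L
  have hΘabs : ∀ v w, |sphereMark Ξ v w| ≤ CΘ := fun v w => abs_sphereMark_evenMarkTrunc_le k l hL v w
  have hCΘ0 : 0 ≤ CΘ := (abs_nonneg _).trans (hΘabs 0 0)
  have hΘb : |Θb| ≤ CΘ := abs_integral_sphereMark_le u θ k l hL
  -- uniform bounds on `B_r` and `Q`
  have hpFabs : ∀ z, |pF z x₀| ≤ M * M * CΘ := fun z => abs_pairFunctional_evenMarkTrunc_le k l hL hr z x₀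
  have hQabs : ∀ z, |Q z| ≤ M * M := fun z => by
    simp only [hQ]
    refine (abs_const_mul_sum_sum_le_of (B := M * M) (mul_nonneg (inv_nonneg.2 hn0.le) (inv_nonneg.2 hn0.le))
      _ fun i j => ?_).trans (le_of_eq ?_)
    · split_ifs
      · rw [abs_zero]; exact mul_nonneg hM0 hM0
      · rw [abs_mul, abs_of_nonneg (hbM z i).1, abs_of_nonneg (hbM z j).1]
        exact mul_le_mul (hbM z i).2 (hbM z j).2 (hbM z j).1 hM0
    · have hN : ((N : ℝ) + 1) ≠ 0 := by positivity
      rw [hn]; push_cast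
      field_simp
  -- the mollified density as a sum, and the deterministic estimate
  have hρsum : ∀ z : Config (N + 1) (Fin 3) T3, mollDensity r z x₀ = n⁻¹ * ∑ i, b z i := fun z => by
    rw [mollDensity_eq_sum]
  have hρ0 : ∀ z : Config (N + 1) (Fin 3) T3, 0 ≤ s * mollDensity r z x₀ := fun z =>
    mul_nonneg hs.le (mollDensity_nonneg hr z x₀)
  have hdev : ∀ z : Config (N + 1) (Fin 3) T3, |ψ (s * mollDensity r z x₀) * Q z - ψ s| ≤
      A * ε + C' * (mollDensity r z x₀ - 1) ^ 2 + K * M ^ 2 * n⁻¹ := fun z => by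
    rw [hρsum]
    exact abs_mul_offDiag_sub_le hK hM0 hs hε hδ hcont (b z) (hbM z)
  have hDz : ∀ z : Config (N + 1) (Fin 3) T3, |ψ (s * mollDensity r z x₀) * Q z - ψ s| ≤ D := fun z => by
    refine (abs_sub _ _).trans (add_le_add ?_ (hK s hs.le))
    rw [abs_mul]
    exact mul_le_mul (hK _ (hρ0 z)) (hQabs z) (abs_nonneg _) hK0
  -- the pointwise bound
  have hpt : ∀ z : Config (N + 1) (Fin 3) T3, (ψ (s * mollDensity r z x₀) * pF z x₀ - ψ s * Θb) ^ 2 ≤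
      2 * K ^ 2 * (pF z x₀ - Θb * Q z) ^ 2 + 2 * Θb ^ 2 * D *
        (A * ε + C' * (mollDensity r z x₀ - 1) ^ 2 + K * M ^ 2 * n⁻¹) := fun z => by
    refine (sq_sub_le_split (hK _ (hρ0 z)) (hDz z)).trans ?_
    exact add_le_add le_rfl (mul_le_mul_of_nonneg_left (hdev z)
      (mul_nonneg (mul_nonneg zero_le_two (sq_nonneg _)) hD0))
  -- continuity / measurability of the pieces
  have hbc : ∀ i : Fin (N + 1), Continuous fun z : Config (N + 1) (Fin 3) T3 => b z i := fun i =>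
    continuous_coneKernel_comp r (continuous_apply i).fst continuous_const
  have hρc : Continuous fun z : Config (N + 1) (Fin 3) T3 => mollDensity r z x₀ :=
    continuous_mollDensity_comp r continuous_id continuous_const
  have hpFc : Continuous fun z : Config (N + 1) (Fin 3) T3 => pF z x₀ :=
    continuous_pairFunctional_comp r hΞc continuous_id continuous_const
  have hQc : Continuous Q := by
    refine continuous_const.mul (continuous_finsetSum _ fun i _ => continuous_finsetSum _ fun j _ => ?_)
    split_ifs
    · exact continuous_const
    · exact (hbc i).mul (hbc j)
  have hLm : Measurable fun z : Config (N + 1) (Fin 3) T3 =>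
      (ψ (s * mollDensity r z x₀) * pF z x₀ - ψ s * Θb) ^ 2 :=
    (((hψm.comp (continuous_const.mul hρc).measurable).mul hpFc.measurable).sub measurable_const).pow_const 2
  have hLb : ∀ z : Config (N + 1) (Fin 3) T3,
      |(ψ (s * mollDensity r z x₀) * pF z x₀ - ψ s * Θb) ^ 2| ≤ (K * (M * M * CΘ) + K * CΘ) ^ 2 := fun z => by
    rw [abs_pow]
    refine pow_le_pow_left₀ (abs_nonneg _) ((abs_sub _ _).trans (add_le_add ?_ ?_)) 2
    · rw [abs_mul]; exact mul_le_mul (hK _ (hρ0 z)) (hpFabs z) (abs_nonneg _) hK0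
    · rw [abs_mul]; exact mul_le_mul (hK _ hs.le) hΘb (abs_nonneg _) hK0
  have hLi : Integrable (fun z => (ψ (s * mollDensity r z x₀) * pF z x₀ - ψ s * Θb) ^ 2) G :=
    Integrable.of_bound hLm.aestronglyMeasurable _ (ae_of_all _ fun z => by rw [Real.norm_eq_abs]; exact hLb z)
  have hαm : Measurable fun z : Config (N + 1) (Fin 3) T3 => (pF z x₀ - Θb * Q z) ^ 2 :=
    ((hpFc.sub (continuous_const.mul hQc)).pow 2).measurable
  have hαb : ∀ z, |(pF z x₀ - Θb * Q z) ^ 2| ≤ (M * M * CΘ + CΘ * (M * M)) ^ 2 := fun z => by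
    rw [abs_pow]
    refine pow_le_pow_left₀ (abs_nonneg _) ((abs_sub _ _).trans (add_le_add (hpFabs z) ?_)) 2
    rw [abs_mul]; exact mul_le_mul hΘb (hQabs z) (abs_nonneg _) hCΘ0
  have hαi : Integrable (fun z => (pF z x₀ - Θb * Q z) ^ 2) G :=
    Integrable.of_bound hαm.aestronglyMeasurable _ (ae_of_all _ fun z => by rw [Real.norm_eq_abs]; exact hαb z)
  have hVc : Continuous fun z : Config (N + 1) (Fin 3) T3 => (mollDensity r z x₀ - 1) ^ 2 := (hρc.sub continuous_const).pow 2
  have hVb : ∀ z : Config (N + 1) (Fin 3) T3, |(mollDensity r z x₀ - 1) ^ 2| ≤ (M + 1) ^ 2 := fun z => by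
    rw [abs_pow]
    refine pow_le_pow_left₀ (abs_nonneg _) ((abs_sub _ _).trans (add_le_add ?_ (by norm_num))) 2
    rw [abs_of_nonneg (mollDensity_nonneg hr z x₀), hρsum]
    calc n⁻¹ * ∑ i, b z i ≤ n⁻¹ * ∑ _i : Fin (N + 1), M :=
          mul_le_mul_of_nonneg_left (Finset.sum_le_sum fun i _ => (hbM z i).2) (inv_nonneg.2 hn0.le)
      _ = M := by
          rw [Finset.sum_const, Finset.card_univ, Fintype.card_fin, nsmul_eq_mul, ← hn, ← mul_assoc,
            inv_mul_cancel₀ hn0.ne', one_mul]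
  have hVi : Integrable (fun z => (mollDensity r z x₀ - 1) ^ 2) G :=
    Integrable.of_bound hVc.measurable.aestronglyMeasurable _ (ae_of_all _ fun z => by rw [Real.norm_eq_abs]; exact hVb z)
  -- (i) the velocity variance term
  have hAterm : ∫ z, (pF z x₀ - Θb * Q z) ^ 2 ∂G ≤ 8 * M ^ 4 * CΘ ^ 2 * n⁻¹ := by
    rw [hG, integral_localGibbsLaw_const_eq_integral_integral σ ha.le hθ u N Φ hαi]
    have hinner : ∀ xs : Fin (N + 1) → T3,
        ∫ vs, (pF (zipConfig (xs, vs)) x₀ - Θb * Q (zipConfig (xs, vs))) ^ 2 ∂Γ ≤ 8 * M ^ 4 * CΘ ^ 2 * n⁻¹ := by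
      intro xs
      have h := integral_vel_sq_pairFunctional_sub_le u θ k l hL hr xs x₀
      simpa only [hpF, hQ, hb, zipConfig_apply] using h
    calc ∫ xs, ∫ vs, (pF (zipConfig (xs, vs)) x₀ - Θb * Q (zipConfig (xs, vs))) ^ 2 ∂Γ ∂P
        ≤ ∫ _xs, 8 * M ^ 4 * CΘ ^ 2 * n⁻¹ ∂P :=
          integral_mono_of_nonneg (ae_of_all _ fun xs => integral_nonneg fun vs => sq_nonneg _)
            (integrable_const _) (ae_of_all _ hinner)
      _ = 8 * M ^ 4 * CΘ ^ 2 * n⁻¹ := by rw [integral_const, smul_eq_mul, probReal_univ, one_mul]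
  -- (ii) the position variance term
  have hVterm : ∫ z, (mollDensity r z x₀ - 1) ^ 2 ∂G = ∫ xs, (empDensity r xs x₀ - 1) ^ 2 ∂P := by
    have h := integral_pos_localGibbsLaw_const σ ha.le hθ u N Φ (fun xs => (empDensity r xs x₀ - 1) ^ 2)
    refine (integral_congr_ae (ae_of_all _ fun z => ?_)).trans h
    simp only [hρsum, empDensity, hb, hn]
  -- assemble
  have hI1 : Integrable (fun z => 2 * K ^ 2 * (pF z x₀ - Θb * Q z) ^ 2) G := hαi.const_mul _
  have hI2 : Integrable (fun z : Config (N + 1) (Fin 3) T3 => C' * (mollDensity r z x₀ - 1) ^ 2) G :=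
    hVi.const_mul _
  have hI3 : Integrable (fun z : Config (N + 1) (Fin 3) T3 => A * ε + C' * (mollDensity r z x₀ - 1) ^ 2) G :=
    (integrable_const _).add hI2
  have hI4 : Integrable (fun z : Config (N + 1) (Fin 3) T3 =>
      A * ε + C' * (mollDensity r z x₀ - 1) ^ 2 + K * M ^ 2 * n⁻¹) G := hI3.add (integrable_const _)
  have hI5 : Integrable (fun z : Config (N + 1) (Fin 3) T3 =>
      2 * Θb ^ 2 * D * (A * ε + C' * (mollDensity r z x₀ - 1) ^ 2 + K * M ^ 2 * n⁻¹)) G := hI4.const_mul _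
  have hI6 : Integrable (fun z => 2 * K ^ 2 * (pF z x₀ - Θb * Q z) ^ 2 +
      2 * Θb ^ 2 * D * (A * ε + C' * (mollDensity r z x₀ - 1) ^ 2 + K * M ^ 2 * n⁻¹)) G := hI1.add hI5
  have hstep : ∫ z, (2 * K ^ 2 * (pF z x₀ - Θb * Q z) ^ 2 +
      2 * Θb ^ 2 * D * (A * ε + C' * (mollDensity r z x₀ - 1) ^ 2 + K * M ^ 2 * n⁻¹)) ∂G =
      2 * K ^ 2 * ∫ z, (pF z x₀ - Θb * Q z) ^ 2 ∂G + 2 * Θb ^ 2 * D *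
        (A * ε + C' * ∫ z, (mollDensity r z x₀ - 1) ^ 2 ∂G + K * M ^ 2 * n⁻¹) := by
    rw [integral_add hI1 hI5, integral_const_mul, integral_const_mul, integral_add hI3 (integrable_const _),
      integral_add (integrable_const _) hI2, integral_const_mul, integral_const, integral_const,
      smul_eq_mul, smul_eq_mul, probReal_univ, one_mul, one_mul, integral_const_mul]
  calc ∫ z, (ψ (s * mollDensity r z x₀) * pF z x₀ - ψ s * Θb) ^ 2 ∂G
      ≤ ∫ z, (2 * K ^ 2 * (pF z x₀ - Θb * Q z) ^ 2 + 2 * Θb ^ 2 * D *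
          (A * ε + C' * (mollDensity r z x₀ - 1) ^ 2 + K * M ^ 2 * n⁻¹)) ∂G := integral_mono hLi hI6 hpt
    _ ≤ 2 * K ^ 2 * (8 * M ^ 4 * CΘ ^ 2 * n⁻¹) + 2 * Θb ^ 2 * D *
          (A * ε + C' * ∫ xs, (empDensity r xs x₀ - 1) ^ 2 ∂P + K * M ^ 2 * n⁻¹) := by
        rw [hstep, hVterm]
        exact add_le_add (mul_le_mul_of_nonneg_left hAterm (by positivity)) le_rfl


/-- **Registered helper stub `stub_enskogRateSqDeviationRung0`** (signature form of
`integral_sq_deviation_le`, hypotheses as arrows): the mean-square deviation bound at one point of the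
torus under the rung-0 local Gibbs law. [folklore] -/
theorem stub_enskogRateSqDeviationRung0 :
    ∀ (σ a θ : ℝ) (u : V3), 0 < σ → σ ≤ 1 / 2 → 0 < a → 0 < θ → ∀ (ψ : ℝ → ℝ) (K ε δ : ℝ), Measurable ψ →
      (∀ y, 0 ≤ y → |ψ y| ≤ K) → 0 < ε → 0 < δ → (∀ y, |y - σ ^ 3| < δ → |ψ y - ψ (σ ^ 3)| < ε) →
      ∀ (k l : Fin 3) (L r : ℝ), 0 ≤ L → 0 < r → ∀ (x₀ : UnitAddTorus (Fin 3)) (N : ℕ) (Φ : HardSphereFlow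
      (Torus.geometry (Fin 3)) (hsDiameter σ N) (N + 1)), ∫ z,
      (ψ (σ ^ 3 * mollDensity r z x₀) * pairFunctional r (evenMarkTrunc k l L) z x₀ - ψ (σ ^ 3) * ∫ p : V3
      × V3, sphereMark (evenMarkTrunc k l L) p.1 p.2 ∂((gaussMeasure u θ).prod (gaussMeasure u θ))) ^ 2
      ∂(localGibbsLaw σ (fun _ => a) (fun _ => u) (fun _ => θ) N Φ) ≤ 2 * K ^ 2 * (8 * (3 / (Real.pi * r ^
      3)) ^ 4 * (2 * L * (2 * L) * (sphereMeasure : MeasureTheory.Measure (Metric.sphere (0 : V3) 1)).real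
      Set.univ) ^ 2 * (((N + 1 : ℕ) : ℝ))⁻¹) + 2 * (∫ p : V3 × V3,
      sphereMark (evenMarkTrunc k l L) p.1 p.2 ∂((gaussMeasure u θ).prod (gaussMeasure u θ))) ^ 2 * (K *
      ((3 / (Real.pi * r ^ 3)) * (3 / (Real.pi * r ^ 3))) + K) * ((K * (3 / (Real.pi * r ^ 3) + 1) + 1) *
      ε + (K * (3 / (Real.pi * r ^ 3) + 1) / (4 * ε) + 2 * K * (σ ^ 3) ^ 2 / δ ^ 2) * ∫ xs,
      (empDensity r xs x₀ - 1) ^ 2 ∂posGibbsMeasure (fun _ : UnitAddTorus (Fin 3) => a) (hsDiameter σ N)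
      (N + 1) + K * (3 / (Real.pi * r ^ 3)) ^ 2 * (((N + 1 : ℕ) : ℝ))⁻¹) :=
  fun _σ _a _θ _u hσ hσ2 ha hθ _ψ _K _ε _δ hψm hK hε hδ hcont k l _L _r hL hr x₀ N Φ =>
    integral_sq_deviation_le hσ hσ2 ha hθ hψm hK hε hδ hcont k l hL hr x₀ N Φ

end Summit.AtomisticToContinuum.HydrodynamicLimit.Theorems.EvenStressEnskog

end
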